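import Summits.NavierStokesRegularity.NavierStokesRegularity.Theses.RootDecompFrostmanHorizon
import Summits.NavierStokesRegularity.NavierStokesRegularity.Theorems.QuarterJoltTypeIEnergyEquality

/-!
# `RootDecompFrostmanHorizon` — EXACTNESS certificate and the Type-I rung (decomp-ns node N32, writer g29)

Kernel record of the root-decomposition node N32 (lens-5 g4 «FROSTMAN HORIZON»), a child of
`RootDecompTerminalEnergy` at its item J1 `AtomFreeBlowupIsTame` (stmt-NavierStokesRegularity-24829):

* `atomFreeBlowupIsTame_iff_pieces` — the node is EXACT: `J1 ↔ (A ∧ B)` with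
  A = `RootDecompFrostmanHorizon.LinearLocalDefect` (stmt-27078, declared residual) and
  B = `RootDecompFrostmanHorizon.LinearDefectIsTame` (stmt-27079, attacked). Stated as an `Iff` between OPEN items
  (certificate shape; it closes nothing).
* `linearLocalDefect_typeI_rung` — the BC5 rung in binder shape: on a TYPE-I first blow-up the local terminal defect is
  linear (indeed the global defect vanishes), by the tree theorem
  `Theorems.NoTerminalJolt.tendsto_eLpNorm_sub_of_isTypeIBlowup` [cite: LeslieShvydkoy2017, Theorem 1.2].

No `def`s; nothing here proves NS regularity (rung 0).
-/

set_option linter.dupNamespace false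

namespace Summit.NavierStokesRegularity.NavierStokesRegularity.Theorems.RootDecompFrostmanHorizonExactness

open scoped Topology ENNReal NNReal
open Filter Set MeasureTheory Metric
open Literature.Analysis.FluidPDE
open Summit.NavierStokesRegularity.NavierStokesRegularity.Theses.RootDecompTerminalEnergy (AtomFreeBlowupIsTame)
open Summit.NavierStokesRegularity.NavierStokesRegularity.Theses.RootDecompFrostmanHorizon
  (LinearLocalDefect LinearDefectIsTame)

/-- Helper: global `L²` convergence `u(t) → u(T)` makes every local defect eventually `≤ 1 · r` on `B_r(x₀)`. -/
theorem eventually_localDefect_le_of_tendsto {T : ℝ} {u : ℝ → EuclideanSpace ℝ (Fin 3) → EuclideanSpace ℝ (Fin 3)}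
    (h : Tendsto (fun t => eLpNorm (u t - u T) 2 volume) (𝓝[<] T) (𝓝 0))
    (x₀ : EuclideanSpace ℝ (Fin 3)) {r : ℝ} (hr : 0 < r) :
    ∀ᶠ t in 𝓝[<] T,
      ∫⁻ x in ball x₀ r, ‖u t x - u T x‖ₑ ^ 2 ≤ ((1 : NNReal) : ℝ≥0∞) * ENNReal.ofReal r := by
  have hsq : Tendsto (fun t => ∫⁻ x, ‖u t x - u T x‖ₑ ^ 2) (𝓝[<] T) (𝓝 0) := by
    have h2 := ((ENNReal.continuous_pow 2).tendsto 0).comp h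
    rw [zero_pow two_ne_zero] at h2
    refine h2.congr fun t => ?_
    have h3 := lintegral_enorm_sq_eq_eLpNorm_two_sq (volume : Measure (EuclideanSpace ℝ (Fin 3))) (u t - u T)
    simp only [Pi.sub_apply] at h3
    simpa [Function.comp] using h3.symm
  have hpos : (0 : ℝ≥0∞) < ENNReal.ofReal r := ENNReal.ofReal_pos.2 hr
  filter_upwards [ENNReal.tendsto_nhds_zero.1 hsq _ hpos] with t ht
  calc ∫⁻ x in ball x₀ r, ‖u t x - u T x‖ₑ ^ 2
      ≤ ∫⁻ x, ‖u t x - u T x‖ₑ ^ 2 := setLIntegral_le_lintegral _ _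
    _ ≤ ENNReal.ofReal r := ht
    _ = ((1 : NNReal) : ℝ≥0∞) * ENNReal.ofReal r := by simp

/-- EXACTNESS of node N32: J1 `AtomFreeBlowupIsTame` ⟺ (A `LinearLocalDefect` ∧ B `LinearDefectIsTame`). -/
theorem atomFreeBlowupIsTame_iff_pieces : AtomFreeBlowupIsTame ↔ (LinearLocalDefect ∧ LinearDefectIsTame) := by
  refine ⟨fun h => ⟨?_, ?_⟩, fun h => ?_⟩
  · intro ν T hν hT u p hmax hLH hdec hatom
    exact ⟨1, 1, one_pos, fun x₀ r hr _ =>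
      eventually_localDefect_le_of_tendsto (h ν T hν hT u p hmax hLH hdec hatom) x₀ hr⟩
  · exact fun ν T hν hT u p hmax hLH hdec hatom _ => h ν T hν hT u p hmax hLH hdec hatom
  · exact fun ν T hν hT u p hmax hLH hdec hatom =>
      h.2 ν T hν hT u p hmax hLH hdec hatom (h.1 ν T hν hT u p hmax hLH hdec hatom)

/-- The Type-I RUNG of A (and of J1) in binder shape: on a Type-I first blow-up of a rapidly decaying smooth Leray–Hopf flow
the local terminal defect is linear — in fact `‖u(t) − u(T)‖₂ → 0` (tree theorem, Leslie–Shvydkoy Thm 1.2); no atom-freeness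
is needed. NS regularity restricted to Type I (`NoTypeIBlowup`, stmt-1217) is OPEN, so the rung lies outside S's known regime. -/
theorem linearLocalDefect_typeI_rung {ν T : ℝ} (hν : 0 < ν) (hT : 0 < T)
    {u : ℝ → EuclideanSpace ℝ (Fin 3) → EuclideanSpace ℝ (Fin 3)} {p : ℝ → EuclideanSpace ℝ (Fin 3) → ℝ}
    (hmax : IsMaximalSmoothSolution ν 0 u p T) (hLH : IsLerayHopfOn T ν 0 (u 0) u)
    (hdec : HasRapidSpatialDecay (u 0)) (hTI : IsTypeIBlowup u T) :
    ∃ C : NNReal, ∃ r₀ : ℝ, 0 < r₀ ∧ ∀ (x₀ : EuclideanSpace ℝ (Fin 3)) (r : ℝ), 0 < r → r < r₀ →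
      ∀ᶠ t in 𝓝[<] T, ∫⁻ x in ball x₀ r, ‖u t x - u T x‖ₑ ^ 2 ≤ (C : ℝ≥0∞) * ENNReal.ofReal r :=
  ⟨1, 1, one_pos, fun x₀ _ hr _ => eventually_localDefect_le_of_tendsto
    (Summit.NavierStokesRegularity.NavierStokesRegularity.Theorems.NoTerminalJolt.tendsto_eLpNorm_sub_of_isTypeIBlowup
      hν hT hmax.1 hLH hdec hTI) x₀ hr⟩

end Summit.NavierStokesRegularity.NavierStokesRegularity.Theorems.RootDecompFrostmanHorizonExactness
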